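import Summits.CriticalPhenomena.Ising3D.Control2DL15TwoSided097
import Summits.CriticalPhenomena.Ising3D.Control2DL15BoxU
import Mathlib.Tactic.NormNum
import HarnessLib

/-!
# The complete RB-4 class-1 2D statement in the kernel: `0.975 < Δ_ε < 1.0001` at `Δ_σ = 1/8` under `A2D′`, no window (Λ = 15)
(cell `pub-ising3x`, seat controls-1 gen 18; KERNEL PATH for the 2D γ-certificates, Λ ≤ 15 class-1 cover — CONTROL-ONLY)

HONEST FRAMING: lottery ticket; floor = tightest certified 3D Ising CFT bounds; no exact-solution
claim without a proof. CONTROL-ONLY (`d = 2`, `Δ_σ = 1/8`, axiom set `A2D′`); nothing about `d = 3`; weaker than the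
reader-certified statement of record (`0.99 < Δ_ε < 1.00005`, Λ = 19, readers A ∧ B).

The last RB-4 Λ = 15 / E₀ = 40 box, U `[97/100, 39/40]` (`j127796`; truncation `Nd = 71` at spin 0, the first `Nd = 71`
cell data in the kernel; `Control2DL15BoxU`), appended to `excludedOn_2d_cover097`:
* `excludedOn_2d_cover0975 : ExcludedOn (1/8) 2 1 (Icc 0 (39/40))`;
* `twoSided_2d_kernel0975 (w) : TwoSided (1/8) 2 1 w (39/40) (10001/10000)` for EVERY real `w` — under `A2D′` at
  `Δ_σ = 1/8`: `0.975 < Δ_ε < 1.0001` (2D Ising: `Δ_ε = 1`) = the reader-certified RB-4 statement of record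
  (`cover_v11.json`: seven Λ = 15 certificates A ∧ B) now resting on the Lean kernel alone. No facts, standard axioms only.
-/

namespace Summit.CriticalPhenomena.Ising3D.Control2D

open Set
open Literature.MathematicalPhysics.QuantumFieldTheory.ConformalBootstrap3D

/-- **Kernel-complete cover of the `ε` locations `[0, 39/40]`** at `Δ_σ = 1/8` under `A2D′` (box U appended).
CONTROL-ONLY (d = 2). [cite: RattazziEtAl2008, §5.5] -/
theorem excludedOn_2d_cover0975 : ExcludedOn (1 / 8 : ℝ) 2 1 (Icc (0 : ℝ) (39 / 40)) :=
  excludedOn_Icc_append excludedOn_2d_cover097 excludedOn_2d_L15_boxU le_rfl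

/-- **2D control, class 1, kernel-complete — the RB-4 statement of record (Λ = 15, E₀ = 40), for EVERY window
parameter `w`**: under `A2D′` at `Δ_σ = 1/8` the `ε` location satisfies `39/40 < Δ_ε < 10001/10000`. CONTROL-ONLY (d = 2).
[cite: RattazziEtAl2008, §5.5] -/
theorem twoSided_2d_kernel0975 (w : ℝ) : TwoSided (1 / 8 : ℝ) 2 1 w (39 / 40) (10001 / 10000) :=
  twoSided_of_cover_zero excludedOn_2d_cover0975 gapExcluded_2d_L15_gapB (by norm_num) w

end Summit.CriticalPhenomena.Ising3D.Control2D
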